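import Summits.ResolutionOfSingularities.ResolutionOfSingularities.Theorems.PurelyInseparableDim4TschirnhausClean
import Summits.ResolutionOfSingularities.ResolutionOfSingularities.Theorems.PurelyInseparableDim4EbarCert
import Summits.ResolutionOfSingularities.ResolutionOfSingularities.Theorems.PurelyInseparableDim4ResConeChart
import Summits.ResolutionOfSingularities.ResolutionOfSingularities.Theorems.PurelyInseparableDim4StepKitTranslate
import HarnessLib
import HarnessLib.Audit.Tags

/-!
# Purely inseparable four-folds — LOCATED REMARK ‖ K: off the band, `e_G` of a presented state is
# FRAME-DEPENDENT (cell `res-dim4-pi`, K2(p) lane, brick (ii); desk WORD #104 (a))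

[OURS · counted 0 · cell `res-dim4-pi` · located remark of res-dim4-p-11 g3 (FILE E part 1 docstring,
bus 2026-08-28T23:37:49Z), certificate asked by the desk (WORD #104 (a)).]  Nothing here proves K2(p),
`NoIsolatedTrap p p` or resolution of singularities in dimension ≥ 4 / characteristic `p`; it is a fact about
OUR frame (the letters `resForm` / `resVertex` / `e_G` of `…ResCone`).  AI kernel work, weaker than expert review.

THE SPECIMEN (`p = 3`, letters `x₀, x₁, x₂, x₃`, contact letter `f = x₃`): the presented state
`s₀ = (F, r, exc) = (x₀²x₁²x₃², (2,2,0,0), {x₀, x₁})` is clean, of order `6 = 2p` (OFF the band `p < ord₀ F < 2p`),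
shade `2 < p`, residual cone `g = x₃²`, `e_G = dim Vtx = 3`.  The datum `φ = x₀ + x₁` is admissible for the move
`tsch f φ : x₃ ↦ x₃ + x₀ + x₁` of FILE B1 (`f` free: `r_f = 0`, `f ∉ exc`; `φ(0) = 0`, `x_f ∉ vars φ`).  The moved
`F` is `x₀²x₁²(x₃ + x₀ + x₁)²`, whose monomial `2·x₀³x₁³` is a cube and is deleted by the mandatory re-cleaning:
the re-framed presented state `T = (clean (tsch F), r, exc)` has residual cone `x₃² + 2x₀x₃ + 2x₁x₃ + x₀² + x₁²`,
whose polar kernel is the line `K·e₂`: **`e_G` drops from `3` to `1`** (`finrank_resVertex_specimen`,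
`finrank_resVertex_reframed_specimen`).  So `e_G` — and with it the slice letter (B: `e_G ≡ 3`, C: `e_G ≡ 2`) —
is NOT an invariant of the singularity-with-boundary off the band; FILE E part 1's `resForm_cleanTschState_eq` /
part 1b's `finrank_resVertex_cleanTschState` are the positive statements IN the band `p ∤ ord₀ F`, where every
isolated above-floor chain lives (`BandShade.exists_ordZero_eq`: `p < ord₀ F ≤ 2p − 2`).  The slices are therefore
stated — correctly — on presented chains, and the re-framings of FILE E preserve them there.
bears_on: LADDER-RESOLUTION:D157-DOOR2 (res-dim4-pi · K2(p) · frame-dependence remark ‖ K).  Supports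
stmt-ResolutionOfSingularities-16155 (helper).
-/

set_option linter.dupNamespace false -- mandated namespace of this single-conjunct summit

noncomputable section

namespace Summit.ResolutionOfSingularities.ResolutionOfSingularities.Theorems.PIDim4

namespace FrameChange

open MvPolynomial Finset
open Literature.AlgebraicGeometry.Resolution
open Literature.AlgebraicGeometry.Resolution.Hauser2010
open Literature.AlgebraicGeometry.Resolution.HauserPerlega2019
open Literature.AlgebraicGeometry.Resolution.CentreBlowup
open StepKit
open PointBlowup (additiveSubspace)

/-! ## 1. Two general readings of the residual cone -/

section General

variable {K : Type} [Field K]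

/-- A non-zero homogeneous polynomial is its own initial form. [folklore] -/
theorem initialForm_eq_self_of_isHomogeneous {P : MvPolynomial (Fin 4) K} {n : ℕ} (hP : P.IsHomogeneous n)
    (h0 : P ≠ 0) : initialForm P = P := by
  unfold initialForm
  rw [ordZero_of_isHomogeneous hP h0, ENat.toNat_coe, homogeneousComponent_of_mem hP, if_pos rfl]

/-- **Reading the residual cone off a factored presentation**: if `s.F = x^r · G` with `G` homogeneous and
non-zero then `resForm s = G`. [folklore] -/
theorem resForm_eq_of_eq_monomial_mul {s : State K} {G : MvPolynomial (Fin 4) K} {n : ℕ}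
    (hF : s.F = monomial s.r 1 * G) (hG : G.IsHomogeneous n) (h0 : G ≠ 0) : ResCone.resForm s = G := by
  classical
  unfold ResCone.resForm
  have hFG : (monomial s.r (1 : K) * G).IsHomogeneous (s.r.degree + n) := by
    have h := (isHomogeneous_monomial (R := K) (d := s.r) 1 rfl).mul hG
    exact h
  have hF0 : monomial s.r (1 : K) * G ≠ 0 :=
    mul_ne_zero (monomial_eq_zero.not.mpr one_ne_zero) h0
  rw [hF, initialForm_eq_self_of_isHomogeneous hFG hF0, divMonomial_monomial_mul]

/-- … and then `e_G = ē(G)` (`RidgeBudget.ebar`, certified on term lists by `EbarCert`). [folklore] -/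
theorem finrank_resVertex_eq_ebar_of_eq_monomial_mul {s : State K} {G : MvPolynomial (Fin 4) K} {n : ℕ}
    (hF : s.F = monomial s.r 1 * G) (hG : G.IsHomogeneous n) (h0 : G ≠ 0) :
    Module.finrank K (ResCone.resVertex s) = RidgeBudget.ebar G := by
  unfold ResCone.resVertex RidgeBudget.ebar
  rw [resForm_eq_of_eq_monomial_mul hF hG h0, initialForm_eq_self_of_isHomogeneous hG h0]

end General

/-! ## 2. The specimen over `𝔽₃` -/

section Specimen

/-- A term list all of whose exponents have total degree `n` presents a homogeneous polynomial. [folklore] -/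
theorem isHomogeneous_evalT_of_forall {R : Type} [CommRing R] {L : Terms 4 R} {n : ℕ}
    (h : ∀ t ∈ L, (∑ i, t.1 i) = n) : (evalT L).IsHomogeneous n := by
  induction L with
  | nil => rw [evalT_nil]; exact isHomogeneous_zero _ _ _
  | cons t L ih =>
    rw [evalT_cons]
    refine (isHomogeneous_monomial _ ?_).add (ih fun t' ht' => h t' (List.mem_cons_of_mem _ ht'))
    rw [degree_expo]
    exact h t List.mem_cons_self

/-- The residual cone `x₃²` of the specimen is homogeneous of degree `2`. [folklore] -/
theorem isHomogeneous_cone_specimen :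
    (evalT [(![0, 0, 0, 2], (1 : ZMod 3))]).IsHomogeneous 2 :=
  isHomogeneous_evalT_of_forall (by decide)

/-- The re-framed residual cone `x₃² + 2x₀x₃ + 2x₁x₃ + x₀² + x₁²` is homogeneous of degree `2`. [folklore] -/
theorem isHomogeneous_cone_reframed_specimen :
    (evalT [(![0, 0, 0, 2], (1 : ZMod 3)), (![1, 0, 0, 1], 2), (![0, 1, 0, 1], 2), (![2, 0, 0, 0], 1),
      (![0, 2, 0, 0], 1)]).IsHomogeneous 2 :=
  isHomogeneous_evalT_of_forall (by decide)

/-- `ē(x₃²) = 3` over `𝔽₃` ‖ K. [OURS · ‖ K] -/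
theorem ebar_cone_specimen : RidgeBudget.ebar (evalT [(![0, 0, 0, 2], (1 : ZMod 3))]) = 3 :=
  EbarCert.ebar_eq_of_certs (q := 2) (V := [![1, 0, 0, 0], ![0, 1, 0, 0], ![0, 0, 1, 0]])
    (W := [![1, 0, 0, 0], ![0, 1, 0, 0], ![0, 0, 1, 0]]) (B := [![0, 0, 0, 1]]) (D := [![0, 0, 0, 2]])
    (by decide +kernel) (by decide +kernel) rfl

/-- `ē(x₃² + 2x₀x₃ + 2x₁x₃ + x₀² + x₁²) = 1` over `𝔽₃` ‖ K (the polar kernel is `K·e₂`). [OURS · ‖ K] -/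
theorem ebar_cone_reframed_specimen :
    RidgeBudget.ebar (evalT [(![0, 0, 0, 2], (1 : ZMod 3)), (![1, 0, 0, 1], 2), (![0, 1, 0, 1], 2),
      (![2, 0, 0, 0], 1), (![0, 2, 0, 0], 1)]) = 1 :=
  EbarCert.ebar_eq_of_certs (q := 2) (V := [![0, 0, 1, 0]]) (W := [![0, 0, 1, 0]])
    (B := [![0, 0, 0, 1], ![1, 0, 0, 0], ![0, 1, 0, 0]]) (D := [![2, 2, 0, 1], ![0, 1, 0, 2], ![1, 0, 0, 2]])
    (by decide +kernel) (by decide +kernel) rfl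

/-- **The specimen state**: `F = x₀²x₁²x₃²` presented with boundary `x₀²x₁²` has `e_G = 3`. [OURS · ‖ K] -/
theorem finrank_resVertex_specimen :
    Module.finrank (ZMod 3) (ResCone.resVertex
      (⟨monomial (expo ![2, 2, 0, 0]) 1 * evalT [(![0, 0, 0, 2], (1 : ZMod 3))], expo ![2, 2, 0, 0], {0, 1}⟩ :
        State (ZMod 3))) = 3 := by
  rw [finrank_resVertex_eq_ebar_of_eq_monomial_mul rfl isHomogeneous_cone_specimen ?_, ebar_cone_specimen]
  rw [Ne, evalT_eq_zero_iff]; decide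

/-- The move `x₃ ↦ x₃ + x₀ + x₁` of the specimen's `F`, expanded over `𝔽₃`:
`x₀²x₁²(x₃ + x₀ + x₁)² = x₀²x₁²x₃² + 2x₀³x₁²x₃ + 2x₀²x₁³x₃ + x₀⁴x₁² + 2x₀³x₁³ + x₀²x₁⁴`. [folklore] -/
theorem tsch_specimen_eq :
    tsch 3 (X 0 + X 1) (monomial (expo ![2, 2, 0, 0]) 1 * evalT [(![0, 0, 0, 2], (1 : ZMod 3))]) =
      evalT [(![2, 2, 0, 2], (1 : ZMod 3)), (![3, 2, 0, 1], 2), (![2, 3, 0, 1], 2), (![4, 2, 0, 0], 1),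
        (![3, 3, 0, 0], 2), (![2, 4, 0, 0], 1)] := by
  simp only [evalT_cons, evalT_nil, add_zero, monomial_expo_eq, Fin.prod_univ_four, map_mul, map_pow,
    map_one, Matrix.cons_val_zero, Matrix.cons_val_one, Matrix.cons_val]
  simp only [show (tsch 3 (X 0 + X 1)) (X 0) = (X 0 : MvPolynomial (Fin 4) (ZMod 3)) from tsch_X_of_ne _ (by decide),
    show (tsch 3 (X 0 + X 1)) (X 1) = (X 1 : MvPolynomial (Fin 4) (ZMod 3)) from tsch_X_of_ne _ (by decide),
    show (tsch 3 (X 0 + X 1)) (X 2) = (X 2 : MvPolynomial (Fin 4) (ZMod 3)) from tsch_X_of_ne _ (by decide),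
    tsch_X_self]
  simp only [pow_zero, pow_one, mul_one, one_mul, map_ofNat]
  ring

/-- The mandatory re-cleaning deletes exactly the cube `2x₀³x₁³`. [folklore] -/
theorem clean_tsch_specimen_eq :
    deletePthPowers 3 (tsch 3 (X 0 + X 1) (monomial (expo ![2, 2, 0, 0]) 1 * evalT [(![0, 0, 0, 2], (1 : ZMod 3))])) =
      monomial (expo ![2, 2, 0, 0]) 1 * evalT [(![0, 0, 0, 2], (1 : ZMod 3)), (![1, 0, 0, 1], 2),
        (![0, 1, 0, 1], 2), (![2, 0, 0, 0], 1), (![0, 2, 0, 0], 1)] := by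
  rw [tsch_specimen_eq, deletePthPowers_evalT]
  have hclean : cleanL 3 [(![2, 2, 0, 2], (1 : ZMod 3)), (![3, 2, 0, 1], 2), (![2, 3, 0, 1], 2),
      (![4, 2, 0, 0], 1), (![3, 3, 0, 0], 2), (![2, 4, 0, 0], 1)] =
      [(![2, 2, 0, 2], (1 : ZMod 3)), (![3, 2, 0, 1], 2), (![2, 3, 0, 1], 2), (![4, 2, 0, 0], 1),
        (![2, 4, 0, 0], 1)] := by decide +kernel
  rw [hclean]
  simp only [evalT_cons, evalT_nil, add_zero, monomial_expo_eq, Fin.prod_univ_four, Matrix.cons_val_zero,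
    Matrix.cons_val_one, Matrix.head_cons, Matrix.cons_val_two, Matrix.cons_val_three, Matrix.tail_cons,
    pow_zero, pow_one, mul_one, one_mul, map_ofNat, C_1]
  ring

/-- **The re-framed specimen state** `T = (clean (tsch F), r, exc)` has `e_G = 1`. [OURS · ‖ K] -/
theorem finrank_resVertex_reframed_specimen :
    Module.finrank (ZMod 3) (ResCone.resVertex
      (⟨deletePthPowers 3 (tsch 3 (X 0 + X 1)
          (monomial (expo ![2, 2, 0, 0]) 1 * evalT [(![0, 0, 0, 2], (1 : ZMod 3))])),
        expo ![2, 2, 0, 0], {0, 1}⟩ : State (ZMod 3))) = 1 := by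
  rw [finrank_resVertex_eq_ebar_of_eq_monomial_mul clean_tsch_specimen_eq isHomogeneous_cone_reframed_specimen ?_,
    ebar_cone_reframed_specimen]
  rw [Ne, evalT_eq_zero_iff]; decide

/-- The specimen's `F` as one term: `x₀²x₁² · x₃² = x₀²x₁²x₃²`. [folklore] -/
theorem specimen_F_eq :
    monomial (expo ![2, 2, 0, 0]) (1 : ZMod 3) * evalT [(![0, 0, 0, 2], (1 : ZMod 3))] =
      evalT [(![2, 2, 0, 2], (1 : ZMod 3))] := by
  simp only [evalT_cons, evalT_nil, add_zero, monomial_mul, one_mul]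
  rw [show expo ![2, 2, 0, 0] + expo ![0, 0, 0, 2] = expo ![2, 2, 0, 2] from
    Finsupp.ext fun i => by fin_cases i <;> rfl]

/-- **THE LOCATED REMARK ‖ K.**  The admissible datum `φ = x₀ + x₁` (`φ(0) = 0`, `x₃ ∉ vars φ`) for the free
contact letter `f = x₃` (`r₃ = 0`, `x₃ ∉ exc`) re-frames the clean presented state
`s₀ = (x₀²x₁²x₃², (2,2,0,0), {x₀,x₁})` of order `6 = 2p` and shade `2` into the clean presented state
`T = (clean (tsch f φ F), r, exc)` of the same order and shade (FILE E part 1 `ordZero_clean_tsch` /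
`shade_cleanTschState`), and `e_G(s₀) = 3 ≠ 1 = e_G(T)`: off the band `p ∤ ord₀ F` the vertex dimension of the
residual cone is presentation-dependent. [OURS · ‖ K · located remark] -/
theorem resVertex_frame_dependence :
    constantCoeff (X 0 + X 1 : MvPolynomial (Fin 4) (ZMod 3)) = 0 ∧
    (3 : Fin 4) ∉ (X 0 + X 1 : MvPolynomial (Fin 4) (ZMod 3)).vars ∧
    (expo ![2, 2, 0, 0]) 3 = 0 ∧ (3 : Fin 4) ∉ ({0, 1} : Finset (Fin 4)) ∧
    deletePthPowers 3 (monomial (expo ![2, 2, 0, 0]) (1 : ZMod 3) * evalT [(![0, 0, 0, 2], (1 : ZMod 3))]) =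
      monomial (expo ![2, 2, 0, 0]) (1 : ZMod 3) * evalT [(![0, 0, 0, 2], (1 : ZMod 3))] ∧
    ordZero (monomial (expo ![2, 2, 0, 0]) (1 : ZMod 3) * evalT [(![0, 0, 0, 2], (1 : ZMod 3))]) = 6 ∧
    CState.shade (⟨monomial (expo ![2, 2, 0, 0]) 1 * evalT [(![0, 0, 0, 2], (1 : ZMod 3))],
      expo ![2, 2, 0, 0], {0, 1}⟩ : State (ZMod 3)) = 2 ∧
    Module.finrank (ZMod 3) (ResCone.resVertex
      (⟨monomial (expo ![2, 2, 0, 0]) 1 * evalT [(![0, 0, 0, 2], (1 : ZMod 3))], expo ![2, 2, 0, 0], {0, 1}⟩ :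
        State (ZMod 3))) = 3 ∧
    Module.finrank (ZMod 3) (ResCone.resVertex
      (⟨deletePthPowers 3 (tsch 3 (X 0 + X 1)
          (monomial (expo ![2, 2, 0, 0]) 1 * evalT [(![0, 0, 0, 2], (1 : ZMod 3))])),
        expo ![2, 2, 0, 0], {0, 1}⟩ : State (ZMod 3))) = 1 := by
  have hord : ordZero (monomial (expo ![2, 2, 0, 0]) (1 : ZMod 3) * evalT [(![0, 0, 0, 2], (1 : ZMod 3))]) = 6 := by
    rw [specimen_F_eq, evalT_cons, evalT_nil, add_zero, ordZero_monomial _ one_ne_zero, degree_expo]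
    decide
  refine ⟨?_, ?_, rfl, by decide, ?_, hord, ?_, finrank_resVertex_specimen, finrank_resVertex_reframed_specimen⟩
  · rw [map_add, constantCoeff_X, constantCoeff_X, add_zero]
  · classical
    intro h
    have h' := MvPolynomial.vars_add_subset _ _ h
    rw [Finset.mem_union, MvPolynomial.vars_X, MvPolynomial.vars_X, Finset.mem_singleton, Finset.mem_singleton] at h'
    exact absurd h' (by decide)
  · rw [specimen_F_eq, deletePthPowers_evalT]
    exact congrArg evalT (by decide +kernel)
  · unfold CState.shade
    dsimp only
    rw [hord, degree_expo]
    decide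

end Specimen


end FrameChange

end Summit.ResolutionOfSingularities.ResolutionOfSingularities.Theorems.PIDim4

end
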